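import Summits.BirchSwinnertonDyer.Rank1Residual.P2.ShuZhaiThirtySixCurve
import Literature.NumberTheory.EllipticCurves.ComplexMultiplicationBurungaleFlachCorOneProofs
import Literature.NumberTheory.QuadraticFields.RingClassNumberFormula
import Literature.NumberTheory.QuadraticFields.BinaryQuadraticFormsPrimeRepresentation
import HarnessLib

/-!
# Cell `bsd-print-cf2` (D-0131 (2) PRINT TIER, leaf CornerF @ `p = 2`), prover p3 — file 2/3: the
# ADMISSIBLE PRIMES of `36a1` (Shu–Zhai 2021 Def 1.1) and the `ℚ(√M)`-splitting condition of Thm 1.4,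
# DISCHARGED in the kernel for `q ≡ 5 (mod 12)` and `M = ∏ q ≡ 1 (mod 24)`

HONEST FRAMING. Companion of `P2/ShuZhaiThirtySixCurve.lean` (file 1/3: the curve `36a1` in the
setting of Shu–Zhai Thm 1.2) and `P2/ShuZhaiThirtySixSlices.lean` (file 3/3: the BY-NAME SLICE of the
W-ALL leaf `Summit.BirchSwinnertonDyer.WAllCornerFTwo`; HONEST FRAMING there). The leaf is OPEN AS A
CLASS; nothing class-wide is closed; no named fact is introduced. This file turns the two remaining
NUMBER-THEORETIC hypotheses of the Shu–Zhai family at `36a1` into congruences, so that the slice can be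
stated on a fully explicit two-parameter family:

* **admissible primes** (Def 1.1: `(q, 2N) = 1`, `q` inert in `ℚ(E[2])` and in `ℚ(E′[2])`): for
  `E = 36a1`, `ℚ(E[2]) = ℚ(√Δ_E) = ℚ(√−3)` and `ℚ(E′[2]) = ℚ(√Δ_{E′}) = ℚ(√3)` (`Δ_E = −432 = −3·12²`,
  `Δ_{E′} = 6912 = 3·48²`; field discriminants `−3` and `12`, the latter by `disc(1, √3) = 12 = r² d_F`
  and Stickelberger `d_F ≡ 0, 1 (mod 4)`), and `q` is inert in both iff `(−3/q) = (12/q) = −1` iff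
  `q ≡ 5 (mod 12)` — exactly Shu–Zhai's list `5, 17, 29, 41, 53, 89, 101, 113, …` (§5.2 Table row
  `36a1`): `isAdmissible_curve36a1`;
* **hypothesis (ii) of Thm 1.4 at `ℚ(√M)`** ("every prime of `2N` splits in `ℚ(√M)`", `M = ∏ q*`):
  for `Q` a finite set of primes `≡ 5 (mod 12)` one has `q* = q`, `M = ∏ q` squarefree `≡ 1 (mod 4)`,
  `d_{ℚ(√M)} = M`, and `2`, `3` split iff `M ≡ 1 (mod 8)` and `M ≡ 1 (mod 3)`, i.e. `M ≡ 1 (mod 24)`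
  (evenly many `q`, evenly many of them `≡ 5 (mod 8)`): `allPrimesSplitInSqrt_two_mul_conductorNorm_prod`.

Tools: the decomposition law and its inert case (tree `satisfiesHeegnerHypothesis_iff_kronecker`,
`RingClass.isPrime_span_natCast_iff_jacobiSym_eq_neg_one`), Euler's evaluation of `(a/q)` by
`q mod 4|a|` (tree `Quadratic.legendreSym_eq_jacobiSym_mod_four_mul`), and the index formula
`disc(1, θ) = r² d_F` (tree `Quadratic.exists_discr_basisOneSqrt_eq_sq_mul_discr`).

References: [ShuZhai2021] Def 1.1, Thm 1.4 (ii), Thm 4.10, §5.2 Table row 36a1 (arXiv:2102.11808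
chunks p0003 L17–L22, L45; p0013; p0014 L87); [Cox2013] §1 Lemma 1.14, §5.B Prop 5.16; [Marcus1977]
Ch. 2 Thm 1 and Exercise 27(c), Ch. 3 Thm 25.
-/

noncomputable section

open scoped Classical

open WeierstrassCurve NumberField Literature.NumberTheory.EllipticCurves
  Literature.NumberTheory.EllipticCurves.Rank1Residual
  Literature.NumberTheory.EllipticCurves.ModularForms
  Literature.NumberTheory.EllipticCurves.ShuZhai2021
  Summit.BirchSwinnertonDyer.Rank1Residual

set_option autoImplicit false

namespace Summit.BirchSwinnertonDyer.Rank1Residual.P2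

/-! ## §1 The admissible primes of `36a1` (Def 1.1): every prime `q ≡ 5 (mod 12)`; and the
`ℚ(√M)`-splitting condition of Thm 1.4 for `M` a product of such primes with `M ≡ 1 (mod 24)` -/

section Admissible

open scoped NumberTheorySymbols

open Literature.NumberTheory.QuadraticFields Literature.NumberTheory.EllipticCurves.Quadratic

/-- `Δ(E′) = 6912 = 2⁸·3³ = 3·48²`. [folklore] -/
theorem curve36a1'_Δ : curve36a1'.Δ = 6912 := by
  simp only [curve36a1', WeierstrassCurve.Δ, WeierstrassCurve.b₂, WeierstrassCurve.b₄, WeierstrassCurve.b₆,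
    WeierstrassCurve.b₈]
  norm_num

/-- **`ℚ(E[2]) = ℚ(√Δ_E) = ℚ(√−3)`**: a quadratic number field containing `√−432 = 12√−3` has
discriminant `−3`. [cite: ShuZhai2021, §5.2 Table row 36a1] [cite: Marcus1977, Ch. 2 Thm. 1] -/
theorem discr_eq_neg_three_of_sq_eq_Δ {F : Type} [Field F] [NumberField F] (h2 : Module.finrank ℚ F = 2)
    {x : F} (hx : x ^ 2 = algebraMap ℚ F curve36a1.Δ) : NumberField.discr F = -3 := by
  rw [curve36a1_Δ] at hx
  refine discr_eq_of_sq_eq_intCast h2 (θ := x / 12) ?_ (by decide)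
  rw [div_pow, hx]
  push_cast
  norm_num

/-- `3` is not a perfect square. [folklore] -/
private theorem not_isSquare_three : ¬ IsSquare (3 : ℕ) := by
  rintro ⟨r, hr⟩
  have : r ≤ 2 := by nlinarith
  interval_cases r <;> omega

/-- No square of a rational number is `3`. [folklore] -/
private theorem not_sq_eq_three (q : ℚ) : q ^ 2 ≠ 3 := by
  intro h
  have h3 : IsSquare ((3 : ℕ) : ℚ) := ⟨q, by push_cast; rw [← h]; ring⟩
  exact not_isSquare_three (Rat.isSquare_natCast_iff.mp h3)

/-- **`ℚ(E′[2]) = ℚ(√Δ_{E′}) = ℚ(√3)`, of discriminant `12`**: a quadratic number field containing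
`√6912 = 48√3` has `d_F = 12` (`disc(1, √3) = 12 = r²·d_F` with `d_F ≡ 0, 1 (mod 4)` forces `r² = 1`).
[cite: ShuZhai2021, §5.2 Table row 36a1] [cite: Marcus1977, Ch. 2 Thm. 1 and Exercise 27(c)] -/
theorem discr_eq_twelve_of_sq_eq_Δ' {F : Type} [Field F] [NumberField F] (h2 : Module.finrank ℚ F = 2)
    {x : F} (hx : x ^ 2 = algebraMap ℚ F curve36a1'.Δ) : NumberField.discr F = 12 := by
  rw [curve36a1'_Δ] at hx
  set θ : F := x / 48 with hθdef
  have hθ2 : θ ^ 2 = 3 := by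
    rw [hθdef, div_pow, hx]; norm_num
  have hrel : θ ^ 2 + algebraMap ℚ F 0 * θ + algebraMap ℚ F (-3) = 0 := by
    simp [hθ2]
  have hθ : θ ∉ Set.range (algebraMap ℚ F) := by
    rintro ⟨q, hq⟩
    apply not_sq_eq_three q
    have h3 : algebraMap ℚ F (q ^ 2) = algebraMap ℚ F 3 := by rw [map_pow, hq, hθ2]; norm_num
    exact (algebraMap ℚ F).injective h3
  have hint : IsIntegral ℤ θ := by
    refine ⟨Polynomial.X ^ 2 - Polynomial.C 3, ?_, ?_⟩
    · exact Polynomial.monic_X_pow_sub_C _ two_ne_zero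
    · simp [hθ2]
  obtain ⟨r, hr0, hr⟩ := Quadratic.exists_discr_basisOneSqrt_eq_sq_mul_discr h2 hθ hint
  rw [Quadratic.discr_basisOneSqrt_of_quadratic h2 hθ hrel] at hr
  have hrZ : (12 : ℤ) = r ^ 2 * NumberField.discr F := by
    have : ((12 : ℤ) : ℚ) = ((r ^ 2 * NumberField.discr F : ℤ) : ℚ) := by push_cast; linarith
    exact_mod_cast this
  -- `d_F ≡ 0, 1 (mod 4)` (Stickelberger, from an integral basis `(1, ω)`)
  obtain ⟨b, hb⟩ := Quadratic.exists_basis_zero_eq_one h2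
  have hd4 := Quadratic.discr_eq_sq_add_four_mul b hb
  set d := NumberField.discr F with hd
  set t := b.repr (b 1 * b 1) 1
  set m := b.repr (b 1 * b 1) 0
  -- `r² ∣ 12`, `r ≠ 0` ⇒ `r² ∈ {1, 4, 9}`; `r² = 4` would give `d = 3 = t² + 4m`, impossible mod `4`
  set n := r.natAbs with hn
  have hr2n : r ^ 2 = (n : ℤ) ^ 2 := (Int.natAbs_sq r).symm
  have hn0 : n ≠ 0 := fun h => hr0 (Int.natAbs_eq_zero.mp h)
  have hdpos : 0 < d := by
    by_contra hle
    have : r ^ 2 * d ≤ 0 := mul_nonpos_of_nonneg_of_nonpos (sq_nonneg r) (not_lt.mp hle)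
    omega
  have hnle : n ≤ 3 := by
    have h1 : (n : ℤ) ^ 2 ≤ 12 := by
      rw [← hr2n]
      calc r ^ 2 = r ^ 2 * 1 := (mul_one _).symm
        _ ≤ r ^ 2 * d := mul_le_mul_of_nonneg_left (by omega) (sq_nonneg r)
        _ = 12 := hrZ.symm
    have h2' : (n : ℤ) ≤ 3 := by nlinarith
    omega
  rw [hr2n] at hrZ
  interval_cases n
  · exact absurd rfl hn0
  · norm_num at hrZ; exact hrZ.symm
  · exfalso
    norm_num at hrZ
    have hd3 : t ^ 2 + 4 * m = 3 := by rw [← hd4]; omega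
    have h4 : ((t ^ 2 + 4 * m : ℤ) : ZMod 4) = ((3 : ℤ) : ZMod 4) := by rw [hd3]
    push_cast at h4
    rw [show (4 : ZMod 4) = 0 from rfl, zero_mul, add_zero] at h4
    exact absurd h4 (by generalize (t : ZMod 4) = z; revert z; decide)
  · exfalso; norm_num at hrZ; omega

/-- `J(12 | q) = −1` for a prime `q ≡ 5 (mod 12)` (`(3/q) = (q/3) = (2/3) = −1`). [cite: Cox2013, §1 Lemma 1.14] -/
private theorem jacobiSym_twelve_eq_neg_one {q : ℕ} (hq : q.Prime) (h12 : q % 12 = 5) : J(12 | q) = -1 := by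
  haveI := Fact.mk hq
  have hq2 : q ≠ 2 := by rintro rfl; norm_num at h12
  rw [← jacobiSym.legendreSym.to_jacobiSym, Quadratic.legendreSym_eq_jacobiSym_mod_four_mul hq2]
  norm_num
  rcases (by omega : q % 48 = 5 ∨ q % 48 = 17 ∨ q % 48 = 29 ∨ q % 48 = 41) with h | h | h | h <;>
    rw [h] <;> norm_num

/-- `J(−3 | q) = −1` for a prime `q ≡ 5 (mod 12)` (`(−3/q) = 1 ⟺ q ≡ 1 (mod 3)`). [cite: Cox2013, §1 (1.8)] -/
private theorem jacobiSym_neg_three_eq_neg_one {q : ℕ} (hq : q.Prime) (h12 : q % 12 = 5) :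
    J(-3 | q) = -1 := by
  haveI := Fact.mk hq
  have hq2 : q ≠ 2 := by rintro rfl; norm_num at h12
  rw [← jacobiSym.legendreSym.to_jacobiSym, Quadratic.legendreSym_eq_jacobiSym_mod_four_mul hq2]
  norm_num
  rw [h12]
  norm_num

/-- **Every prime `q ≡ 5 (mod 12)` is ADMISSIBLE for `36a1`** (Def 1.1: `(q, 2N) = 1`, `q` inert in
`ℚ(E[2]) = ℚ(√−3)` and in `ℚ(E′[2]) = ℚ(√3)`; Shu–Zhai's Table lists `5, 17, 29, 41, 53, 89, 101, 113, …`).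
The inert criterion is `(d_F/q) = −1` (tree `RingClass.isPrime_span_natCast_iff_jacobiSym_eq_neg_one`).
[cite: ShuZhai2021, Def. 1.1 and §5.2 Table row 36a1] [cite: Cox2013, §5.B Prop. 5.16] -/
theorem isAdmissible_curve36a1 {q : ℕ} (hq : q.Prime) (h12 : q % 12 = 5) :
    IsAdmissible curve36a1 curve36a1' q := by
  have hq2 : q ≠ 2 := by rintro rfl; norm_num at h12
  have hq3 : q ≠ 3 := by rintro rfl; norm_num at h12
  refine ⟨hq, ?_, ?_, ?_⟩
  · -- `(q, 2N) = 1`: `2N ∣ 2⁵·3³`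
    have h864 : Nat.Coprime q (2 ^ 5 * 3 ^ 3) :=
      Nat.Coprime.mul_right (((Nat.coprime_primes hq Nat.prime_two).mpr hq2).pow_right 5)
        (((Nat.coprime_primes hq Nat.prime_three).mpr hq3).pow_right 3)
    exact h864.coprime_dvd_right ((mul_dvd_mul_left 2 conductorNorm_curve36a1_dvd).trans (by norm_num))
  · intro F _ _ h2 hx
    obtain ⟨x, hx⟩ := hx
    rw [Int.cast_natCast]
    exact (RingClass.isPrime_span_natCast_iff_jacobiSym_eq_neg_one h2 hq hq2).mpr
      (by rw [discr_eq_neg_three_of_sq_eq_Δ h2 hx]; exact jacobiSym_neg_three_eq_neg_one hq h12)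
  · intro F _ _ h2 hx
    obtain ⟨x, hx⟩ := hx
    rw [Int.cast_natCast]
    exact (RingClass.isPrime_span_natCast_iff_jacobiSym_eq_neg_one h2 hq hq2).mpr
      (by rw [discr_eq_twelve_of_sq_eq_Δ' h2 hx]; exact jacobiSym_twelve_eq_neg_one hq h12)

/-- The `Q`-clause of the setting of Thm 1.2 at `36a1` for a finite set of primes `q ≡ 5 (mod 12)` and
`p ≡ 23 (mod 24)` (so `q ≠ p`). [cite: ShuZhai2021, Thm. 1.2 and §5.2 Table row 36a1] -/
theorem admissible_of_forall_mod_twelve {p : ℕ} (h24 : p % 24 = 23) {Q : Finset ℕ}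
    (hQ : ∀ q ∈ Q, q.Prime ∧ q % 12 = 5) : ∀ q ∈ Q, IsAdmissible curve36a1 curve36a1' q ∧ q ≠ p :=
  fun q hq => ⟨isAdmissible_curve36a1 (hQ q hq).1 (hQ q hq).2, by
    have h5 := (hQ q hq).2
    rintro rfl
    omega⟩

end Admissible

/-! ### The `ℚ(√M)`-condition of Thm 1.4 / Thm 4.10 for `M = ∏_{q ∈ Q} q`, `q ≡ 5 (mod 12)`, `M ≡ 1 (mod 24)` -/

/-- For primes `q ≡ 1 (mod 4)`, `∏ q* = ∏ q`. [cite: ShuZhai2021, §1 (chunk p0003 L22)] -/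
theorem prod_qStar_eq_of_forall_mod_twelve {Q : Finset ℕ} (hQ : ∀ q ∈ Q, q.Prime ∧ q % 12 = 5) :
    (∏ q ∈ Q, qStar q : ℤ) = ((∏ q ∈ Q, q : ℕ) : ℤ) := by
  rw [Nat.cast_prod]
  exact Finset.prod_congr rfl fun q hq => qStar_of_mod_four_eq_one (by have := (hQ q hq).2; omega)

/-- A product of DISTINCT primes is squarefree. [folklore] -/
private theorem squarefree_prod_primes {Q : Finset ℕ} (hQ : ∀ q ∈ Q, q.Prime) : Squarefree (∏ q ∈ Q, q) := by
  classical
  induction Q using Finset.induction_on with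
  | empty => simp
  | insert a s ha ih =>
    rw [Finset.prod_insert ha]
    have hap : a.Prime := hQ a (Finset.mem_insert_self a s)
    have hs : ∀ q ∈ s, q.Prime := fun q hq => hQ q (Finset.mem_insert_of_mem hq)
    refine (Nat.squarefree_mul ?_).mpr ⟨hap.squarefree, ih hs⟩
    refine (Nat.Coprime.prod_right fun q hq => (Nat.coprime_primes hap (hs q hq)).mpr ?_)
    rintro rfl
    exact ha hq

/-- **`d_F = M`** for a quadratic number field `F ∋ √M`, `M > 1` squarefree, `M ≡ 1 (mod 4)`:
`θ = (1 + √M)/2` is a root of `X² − X + (1 − M)/4`, `disc(1, θ) = M = r² d_F`, and `r² ∣ M` squarefree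
forces `r² = 1`. [cite: Marcus1977, Ch. 2 Thm. 1 and Exercise 27(c)] -/
theorem discr_eq_of_sq_eq_of_squarefree {F : Type} [Field F] [NumberField F] (h2 : Module.finrank ℚ F = 2)
    {M : ℕ} (hsq : Squarefree M) (hM1 : M ≠ 1) (hM4 : M % 4 = 1) {y : F} (hy : y ^ 2 = (M : F)) :
    NumberField.discr F = M := by
  obtain ⟨k, hk⟩ : ∃ k : ℤ, (M : ℤ) = 4 * k + 1 := ⟨(M : ℤ) / 4, by omega⟩
  set θ : F := (1 + y) / 2 with hθdef
  have hkF : (M : F) = 4 * (k : F) + 1 := by exact_mod_cast hk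
  have hyθ : y = 2 * θ - 1 := by rw [hθdef]; ring
  -- `θ` is a root of `X² − X − k`
  have hrelZ : θ ^ 2 + ((-1 : ℤ) : F) * θ + ((-k : ℤ) : F) = 0 := by
    have e : θ ^ 2 + ((-1 : ℤ) : F) * θ + ((-k : ℤ) : F) = (y ^ 2 - (4 * (k : F) + 1)) / 4 := by
      rw [hθdef]; push_cast; ring
    rw [e, hy, hkF, sub_self, zero_div]
  have hrel : θ ^ 2 + algebraMap ℚ F (-1) * θ + algebraMap ℚ F (-(k : ℚ)) = 0 := by
    rw [map_neg, map_one, map_neg, map_intCast]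
    push_cast at hrelZ
    exact hrelZ
  have hθ : θ ∉ Set.range (algebraMap ℚ F) := by
    rintro ⟨q, hq⟩
    have h1 : algebraMap ℚ F (2 * q - 1) = y := by
      rw [map_sub, map_mul, map_ofNat, map_one, hq, hyθ]
    have hsqM : IsSquare ((M : ℕ) : ℚ) :=
      ⟨2 * q - 1, (algebraMap ℚ F).injective (by rw [map_natCast, map_mul, h1, ← sq, hy])⟩
    obtain ⟨s, hs⟩ := Rat.isSquare_natCast_iff.mp hsqM
    have hunit : IsUnit s := hsq s ⟨1, by rw [hs, mul_one]⟩
    rw [Nat.isUnit_iff] at hunit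
    rw [hunit] at hs
    exact hM1 hs
  have hint : IsIntegral ℤ θ := by
    refine ⟨Polynomial.X ^ 2 + Polynomial.C (-1 : ℤ) * Polynomial.X + Polynomial.C (-k), ?_, ?_⟩
    · rw [add_assoc]
      refine (Polynomial.monic_X_pow 2).add_of_left (lt_of_le_of_lt Polynomial.degree_linear_le ?_)
      rw [Polynomial.degree_X_pow]
      norm_num
    · rw [Polynomial.eval₂_add, Polynomial.eval₂_add, Polynomial.eval₂_pow, Polynomial.eval₂_mul,
        Polynomial.eval₂_C, Polynomial.eval₂_X, Polynomial.eval₂_C, eq_intCast, eq_intCast]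
      exact hrelZ
  obtain ⟨r, hr0, hr⟩ :=
    Literature.NumberTheory.QuadraticFields.Quadratic.exists_discr_basisOneSqrt_eq_sq_mul_discr h2 hθ hint
  rw [Literature.NumberTheory.QuadraticFields.Quadratic.discr_basisOneSqrt_of_quadratic h2 hθ hrel] at hr
  have hrZ : (M : ℤ) = r ^ 2 * NumberField.discr F := by
    have hkQ : ((M : ℕ) : ℚ) = 4 * (k : ℚ) + 1 := by exact_mod_cast hk
    have : ((M : ℤ) : ℚ) = ((r ^ 2 * NumberField.discr F : ℤ) : ℚ) := by
      push_cast; rw [← hr, hkQ]; ring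
    exact_mod_cast this
  have hunit : IsUnit r := (Int.squarefree_natCast.mpr hsq) r ⟨NumberField.discr F, by rw [hrZ]; ring⟩
  rcases Int.isUnit_iff.mp hunit with rfl | rfl <;> simpa using hrZ.symm

/-- **Hypothesis (ii) of Thm 1.4 at `ℚ(√M)`: every prime of `2N` splits in `ℚ(√M)`** for
`M = ∏_{q∈Q} q*` with `Q` a finite set of primes `q ≡ 5 (mod 12)` and `M ≡ 1 (mod 24)` — i.e. EVENLY
many `q ∈ Q`, evenly many of them `≡ 5 (mod 8)` (for `Q = ∅`, `M = 1` and the condition is empty):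
`d_{ℚ(√M)} = M ≡ 1 (mod 8)` and `(M/3) = 1`. [cite: ShuZhai2021, Thm. 1.4 (ii) and Thm. 4.10]
[cite: Marcus1977, Ch. 3 Thm. 25] -/
theorem allPrimesSplitInSqrt_two_mul_conductorNorm_prod {Q : Finset ℕ} (hQ : ∀ q ∈ Q, q.Prime ∧ q % 12 = 5)
    (hM : (∏ q ∈ Q, q) % 24 = 1) :
    AllPrimesSplitInSqrt (2 * curve36a1.conductorNorm ℤ) (∏ q ∈ Q, qStar q) := by
  rw [prod_qStar_eq_of_forall_mod_twelve hQ]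
  set M : ℕ := ∏ q ∈ Q, q with hMdef
  by_cases hM1 : M = 1
  · exact Or.inl ⟨1, by rw [hM1]; norm_num⟩
  refine Or.inr fun F _ _ h2 ⟨y, hy⟩ => ?_
  have hsq : Squarefree M := squarefree_prod_primes fun q hq => (hQ q hq).1
  have hyM : y ^ 2 = (M : F) := by rw [hy]; push_cast; rfl
  have hD := discr_eq_of_sq_eq_of_squarefree h2 hsq hM1 (by omega) hyM
  have h864 : SatisfiesHeegnerHypothesis (2 ^ 5 * 3 ^ 3) F := by
    rw [satisfiesHeegnerHypothesis_iff_kronecker _ F h2, hD]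
    intro ℓ hℓ hℓN
    rcases (Nat.Prime.dvd_mul hℓ).mp hℓN with h | h
    · obtain rfl := (Nat.prime_dvd_prime_iff_eq hℓ Nat.prime_two).mp (hℓ.dvd_of_dvd_pow h)
      exact ⟨fun _ => by omega, fun h2' => absurd rfl h2'⟩
    · obtain rfl := (Nat.prime_dvd_prime_iff_eq hℓ Nat.prime_three).mp (hℓ.dvd_of_dvd_pow h)
      refine ⟨fun h => absurd h (by norm_num), fun _ => ?_⟩
      have hmod : (M : ℤ) % ((3 : ℕ) : ℤ) = 1 % ((3 : ℕ) : ℤ) := by push_cast; omega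
      rw [jacobiSym.mod_left, hmod, ← jacobiSym.mod_left, jacobiSym.one_left]
  exact h864.of_dvd ((mul_dvd_mul_left 2 conductorNorm_curve36a1_dvd).trans (by norm_num))

end Summit.BirchSwinnertonDyer.Rank1Residual.P2

end
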